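import Literature.NumberTheory.EllipticCurves.FormalGroupHasseInvariantProofs
import Mathlib.RingTheory.Ideal.Quotient.Operations
import HarnessLib

/-!
# The Hasse invariant of the Tate normal form `y² + xy = x³ + a₆` is `≡ 1 (mod a₆)`

`Proofs` file (theorems only, no definitions, no named facts), topic `NumberTheory/EllipticCurves`.

For the normal form `y² + xy = x³ + a₆` of a split multiplicative Weierstrass equation
(`SplitMultiplicativeNormalForm`: `a₁ = 1`, `a₂ = a₃ = a₄ = 0`, `a₆ ∈ 𝔪`) one has
`b₂ = 1`, `b₄ = 0`, `b₆ = 4a₆`, so Hasse's polynomial (`WeierstrassCurve.hasseCoeff`, the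
coefficient of `x^{p-1}` in `(4x³ + b₂x² + 2b₄x + b₆)^{(p-1)/2}`, Silverman *AEC* V.4.1(a)) is the
coefficient of `x^{p-1}` in `(4x³ + x² + 4a₆)^{(p-1)/2}`, which is `≡ [x^{p-1}] x^{p-1}(4x + 1)^{(p-1)/2}
= 1 (mod a₆)`.  Hence:

* `WeierstrassCurve.hasseCoeff_tateNormalForm_zero` — over any commutative ring, for `p` odd,
  `hasseCoeff (y² + xy = x³) p = 1`;
* `WeierstrassCurve.hasseCoeff_tateNormalForm_sub_one_mem` — `hasseCoeff (y² + xy = x³ + c) p - 1 ∈ (c)`;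
* `WeierstrassCurve.isUnit_hasseCoeff_tateNormalForm` — over a local ring with `c ∈ 𝔪`,
  `hasseCoeff (y² + xy = x³ + c) p` is a unit: **a curve with (split) multiplicative reduction has
  invertible Hasse invariant** — its formal group has height `1` (the formal group of the node is
  the formal multiplicative group), Serre 1968, IV, A.1.1; used with the kernel-of-reduction count
  of `KernelReductionOrdinaryTorsionProofs` at a multiplicative place above `ℓ`.

## References

* [SilvermanAEC2009] J. H. Silverman, *The Arithmetic of Elliptic Curves*, 2nd ed., V.4.1(a)
  (Hasse invariant), III.1 (`b₂, b₄, b₆`).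
* [SerreAbelianLadic1968] J.-P. Serre, *Abelian ℓ-adic representations and elliptic curves*
  (1968), Ch. IV, A.1.1 (multiplicative reduction: the formal group is of height 1).
-/

noncomputable section

open Polynomial

namespace WeierstrassCurve

variable {R : Type*} [CommRing R]

/-- The `2`-torsion polynomial of `y² + xy = x³ + c` is `4x³ + x² + 4c`. [Silverman AEC III.1]
[folklore] -/
theorem twoTorsionPolynomial_toPoly_tateNormalForm (c : R) :
    (⟨1, 0, 0, 0, c⟩ : WeierstrassCurve R).twoTorsionPolynomial.toPoly =
      X ^ 2 * (4 * X + 1) + Polynomial.C (4 * c) := by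
  simp only [twoTorsionPolynomial, b₂, b₄, b₆, Cubic.toPoly, map_mul, map_add, map_pow, map_zero,
    map_one, map_ofNat]
  ring

/-- **`A_p(y² + xy = x³) = 1`** for `p` odd: the coefficient of `x^{p-1}` in
`(4x³ + x²)^{(p-1)/2} = x^{p-1}(4x + 1)^{(p-1)/2}` is the constant coefficient of
`(4x + 1)^{(p-1)/2}`. [Silverman AEC V.4.1(a)] [folklore] -/
theorem hasseCoeff_tateNormalForm_zero {p : ℕ} (hp : Odd p) :
    (⟨1, 0, 0, 0, 0⟩ : WeierstrassCurve R).hasseCoeff p = 1 := by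
  obtain ⟨m, rfl⟩ := hp
  have hm : (2 * m + 1 - 1) / 2 = m := by omega
  have hm' : 2 * m + 1 - 1 = 2 * m := by omega
  rw [hasseCoeff, twoTorsionPolynomial_toPoly_tateNormalForm, hm, hm', mul_zero, map_zero, add_zero,
    mul_pow, ← pow_mul, mul_comm (X ^ (2 * m)), Polynomial.coeff_mul_X_pow', if_pos le_rfl,
    Nat.sub_self, Polynomial.coeff_zero_eq_eval_zero, eval_pow, eval_add, eval_mul, eval_ofNat, eval_X,
    mul_zero, zero_add, eval_one, one_pow]

/-- **`A_p(y² + xy = x³ + c) ≡ 1 (mod c)`** for `p` odd (reduce modulo `(c)`, where the equation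
becomes `y² + xy = x³`, and use `hasseCoeff_tateNormalForm_zero`; `hasseCoeff` commutes with ring
homomorphisms, `map_hasseCoeff`). [Silverman AEC V.4.1(a)] [folklore] -/
theorem hasseCoeff_tateNormalForm_sub_one_mem {p : ℕ} (hp : Odd p) (c : R) :
    (⟨1, 0, 0, 0, c⟩ : WeierstrassCurve R).hasseCoeff p - 1 ∈ Ideal.span {c} := by
  rw [← Ideal.Quotient.eq_zero_iff_mem, map_sub, map_one, sub_eq_zero,
    ← map_hasseCoeff (⟨1, 0, 0, 0, c⟩ : WeierstrassCurve R) (Ideal.Quotient.mk (Ideal.span {c})) p]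
  have hc : Ideal.Quotient.mk (Ideal.span {c}) c = 0 :=
    Ideal.Quotient.eq_zero_iff_mem.mpr (Ideal.mem_span_singleton_self c)
  have hmap : (⟨1, 0, 0, 0, c⟩ : WeierstrassCurve R).map (Ideal.Quotient.mk (Ideal.span {c})) =
      ⟨1, 0, 0, 0, 0⟩ := by
    simp only [WeierstrassCurve.map, map_one, map_zero, hc]
  rw [hmap]
  exact hasseCoeff_tateNormalForm_zero hp

/-- **A split multiplicative equation in normal form has invertible Hasse invariant**: over a
local ring `R`, for `c ∈ 𝔪_R` and `p` odd, `A_p(y² + xy = x³ + c) ∈ Rˣ` (it is `≡ 1 mod c`).  In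
words: the formal group at a place of multiplicative reduction has height `1`.
[Serre 1968, IV, A.1.1; Silverman AEC V.4.1(a)] [cite: SerreAbelianLadic1968, IV A.1.1] -/
theorem isUnit_hasseCoeff_tateNormalForm [IsLocalRing R] {p : ℕ} (hp : Odd p) {c : R}
    (hc : c ∈ IsLocalRing.maximalIdeal R) :
    IsUnit ((⟨1, 0, 0, 0, c⟩ : WeierstrassCurve R).hasseCoeff p) := by
  obtain ⟨r, hr⟩ := Ideal.mem_span_singleton'.mp (hasseCoeff_tateNormalForm_sub_one_mem hp c)
  have h : (⟨1, 0, 0, 0, c⟩ : WeierstrassCurve R).hasseCoeff p = 1 + r * c := by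
    rw [hr, add_sub_cancel]
  rw [h]
  by_contra hnu
  have hmem : 1 + r * c ∈ IsLocalRing.maximalIdeal R := (IsLocalRing.mem_maximalIdeal _).mpr hnu
  have h1 : (1 : R) ∈ IsLocalRing.maximalIdeal R := by
    have := Ideal.sub_mem _ hmem (Ideal.mul_mem_left _ r hc)
    rwa [add_sub_cancel_right] at this
  exact (IsLocalRing.maximalIdeal.isMaximal R).ne_top ((Ideal.eq_top_iff_one _).mpr h1)

end WeierstrassCurve

end
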